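import Summits.AtomisticToContinuum.HydrodynamicLimit.Theorems.JParityClosureEvenStressEnskogThreeBodyWindowStatics
import Literature.MathematicalPhysics.KineticTheory.HardSphereCanonicalClusterBound
import Summits.AtomisticToContinuum.HydrodynamicLimit.Theorems.JParityClosureCollisionTightnessSweptTube
import Summits.AtomisticToContinuum.HydrodynamicLimit.Theorems.JParityClosureOddContactSymmetryGibbsInvariance
import HarnessLib

/-!
# Crux `JParityClosure.EvenStressEnskog` (stmt-AtomisticToContinuum-13079), line
# `even-rung-mean-variance`: helper stub `stub_threeBodyCollisionSumRung0` ((S2b₃) at rung 0)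

At RUNG 0 (constant profiles: the local Gibbs law is the homogeneous canonical Gibbs law `G_N`,
stationary under every hard-sphere flow, `measurePreserving_flow_localGibbsLaw_const`) the THREE-BODY
collision-sum residual of the collision-cylinder pull-back,
`N₃(z) = threeBodyCollisionSum σ N Φ τ L κ z` — over the collisions `(s, p, q)` of the orbit of `z` with
`s ∈ (0, τ]`, the number of third particles in the near-contact shell `ε < ‖x_l − x_p‖ ≤ ε(1 + 2Lκ)` of
the colliding particle `p` (`CollisionTubePullbackDefs`) — is small in `G_N`-probability once the tube is
thin: `G_N{η < ε/(N+1) · N₃} ≤ δ` for `κ < κ₀(u, θ, σ, τ, η, δ, L)` and ALL `N`.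

Proof.  `N₃` is the collision sum of the configuration mark `F(w, p, q) = #shell of p in w` (nonnegative,
so the sum over `(0, τ]` is at most the sum over `[0, τ]` used by the window bound).  The window bound
`measure_collisionSum_ge_le_liminf` (`CollisionFluxUpperBound`: pathwise pull-back of every collision to
the next grid time of mesh `τ/M`, stationarity, Fatou, Markov) is fed with
(i) the one-window events `E_M(i, j) = {some lift of x_j − x_i lies in the swept tube of v_i − v_j}`
(`exists_sweptTube`, `exists_latticeVec_add_mem_of_contact`), and
(ii) the majorant `F̃_M(w, i, j) = #{l ∉ {i, j} : ε ≤ dist(x_l, x_i) ≤ ε(1 + 2Lκ) + (τ/M)‖v_i − v_l‖}` of the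
mark along the backward flights (`ofReal_shellCount_freeFlight_le`).  The mean of one window is a sum
over label triples of the static three-label bound `localGibbsLaw_window_shell_le` (rung-0 product law,
Ruelle bound `posGibbs_tripleEvent_le`, exact Haar volume of the thickened shell, Gaussian second
moments): `M · ∫ Σ 𝟙_E F̃ dG_N ≤ A + B/M` with `A = (N+1)³ · 32ε²τ · (1 + 4(‖u‖² + 3θ)) · (28π/3)(2Lκ)ε³` and
`B < ∞`, so the `liminf` over `M` is at most `A`, and the Markov normalisation `ε/(η(N+1))` turns
`(N+1)³ ε⁵ · ε/(N+1) = ((N+1)ε³)² = σ⁶` into the `N`-uniform bound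
`G_N{…} ≤ 64 (28π/3) τ (1 + 4(‖u‖² + 3θ)) L σ⁶ κ / η ≤ δ` for `κ < κ₀ := min (1/(2L)) (ηδ/(C + 1))`.

References: C. Cercignani, R. Illner, M. Pulvirenti, *The Mathematical Theory of Dilute Gases* (1994),
App. 4.A; I. Gallagher, L. Saint-Raymond, B. Texier, *From Newton to Boltzmann* (2013), Prop. 4.1.1;
H. Spohn, *Large Scale Dynamics of Interacting Particles* (1991), Part I §2.3.
-/

noncomputable section

open MeasureTheory Set Filter Topology Metric
open scoped ENNReal InnerProductSpace BigOperators

namespace Summit.AtomisticToContinuum.HydrodynamicLimit.Theorems.EvenStressEnskog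

open Literature.Analysis.FluidPDE Literature.MathematicalPhysics.KineticTheory
open Literature.Analysis.FunctionSpaces

/-! ### The stub -/

/-- **Registered helper stub `stub_threeBodyCollisionSumRung0`** ((S2b₃) at rung 0) of the line
`even-rung-mean-variance` of crux stmt-AtomisticToContinuum-13079: under the rung-0 (homogeneous)
Gibbs law the three-body collision sum `N₃` of the collision-cylinder pull-back (the number of third
particles in the near-contact shell `ε < ‖q‖ ≤ ε(1 + 2Lκ)` of a colliding particle, summed over the
collisions in `(0, τ]`) satisfies `G_N{η < ε/(N+1) · N₃} ≤ δ` for `κ < κ₀(u, θ, σ, τ, η, δ, L)`,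
uniformly in `N`: the window bound `measure_collisionSum_ge_le_liminf` with the three-label static
events of `localGibbsLaw_window_shell_le`, whose mesh error `O(1/M)` disappears in the `liminf`,
leaves `G_N{…} ≤ (64 · 28π/3) τ (1 + 4(‖u‖² + 3θ)) L σ⁶ κ / η`. [folklore] -/
theorem stub_threeBodyCollisionSumRung0 :
    ∀ (a θ : ℝ) (u : V3), 0 < a → 0 < θ → ∃ σ₀ : ℝ, 0 < σ₀ ∧ ∀ σ : ℝ, 0 < σ → σ < σ₀ → ∀ Φ : (N : ℕ) →
      HardSphereFlow (Torus.geometry (Fin 3)) (hsDiameter σ N) (N + 1), ∀ τ : ℝ, 0 < τ → ∀ η δ : ℝ,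
      0 < η → 0 < δ → ∀ L : ℝ, 1 ≤ L → ∃ κ₀ : ℝ, 0 < κ₀ ∧ ∀ κ : ℝ, 0 < κ → κ < κ₀ → ∃ N₀ : ℕ, ∀ N : ℕ,
      N₀ ≤ N → localGibbsLaw σ (fun _ => a) (fun _ => u) (fun _ => θ) N (Φ N) {z | η < hsDiameter σ N / (N
      + 1 : ℝ) * threeBodyCollisionSum σ N (Φ N) τ L κ z} ≤ ENNReal.ofReal δ := by
  intro a θ u ha hθ
  obtain ⟨σ₁, hσ₁, hsmall⟩ := exists_smallDensity uniformProfile one_pos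
  refine ⟨min σ₁ (1 / 8), lt_min hσ₁ (by norm_num), fun σ hσ hσlt Φ τ hτ η δ hη hδ L hL => ?_⟩
  have hsm : SmallDensity uniformProfile σ := (hsmall σ hσ (hσlt.trans_le (min_le_left _ _))).1
  have hσ8 : σ ≤ 1 / 8 := (hσlt.trans_le (min_le_right _ _)).le
  have hσ2 : σ ≤ 1 / 2 := hsm.σ_lt_half.le
  have hL0 : 0 < L := one_pos.trans_le hL
  -- the constants
  set Kv : ℝ := 1 + 4 * (‖u‖ ^ 2 + 3 * θ) with hKv
  have hKv0 : 0 < Kv := by rw [hKv]; positivity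
  set C : ℝ := 64 * (28 * Real.pi / 3) * τ * Kv * L * σ ^ 6 with hC
  have hC0 : 0 < C := by rw [hC]; positivity
  refine ⟨min (1 / (2 * L)) (η * δ / (C + 1)), lt_min (by positivity) (by positivity),
    fun κ hκ hκlt => ⟨0, fun N _ => ?_⟩⟩
  have hκL : 2 * L * κ ≤ 1 := by
    have h1 : κ < 1 / (2 * L) := hκlt.trans_le (min_le_left _ _)
    rw [lt_div_iff₀ (by positivity)] at h1
    linarith
  have hκC : C * κ / η ≤ δ := by
    have h1 : κ < η * δ / (C + 1) := hκlt.trans_le (min_le_right _ _)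
    rw [lt_div_iff₀ (by positivity)] at h1
    rw [div_le_iff₀ hη]
    nlinarith
  -- notation
  set ε := hsDiameter σ N with hεdef
  have hε : 0 < ε := hsDiameter_pos hσ N
  set P := localGibbsLaw σ (fun _ => a) (fun _ => u) (fun _ => θ) N (Φ N) with hP
  -- the swept tubes, one for every mesh `τ / M`
  have htube : ∀ M : ℕ, ∃ S : V3 → Set V3, MeasurableSet {q : V3 × V3 | q.1 ∈ S q.2} ∧
      (∀ v, volume (S v) ≤ ENNReal.ofReal (4 * ε ^ 2 * (τ / M) * ‖v‖)) ∧
      ∀ (v r : V3) (s : ℝ), ε ≤ ‖r‖ → s ∈ Icc 0 (τ / M) → ‖r + s • v‖ = ε → r ∈ S v := fun M =>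
    exists_sweptTube hε (div_nonneg hτ.le (Nat.cast_nonneg M))
  choose S hSm hSvol hScov using htube
  -- the window events, the thickened shells, the mark and its majorant
  set E : ℕ → Fin (N + 1) → Fin (N + 1) → Set (Config (N + 1) (Fin 3) T3) := fun M i j =>
    {w | ∃ k : Fin 3 → ℤ, Torus.reprSym ((w j).1 - (w i).1) +
      Literature.Analysis.FunctionSpaces.Torus.latticeVec k ∈ S M ((w i).2 - (w j).2)} with hE
  set D : ℕ → Fin (N + 1) → Fin (N + 1) → Set (Config (N + 1) (Fin 3) T3) := fun M i l =>
    {w | ε ≤ Torus.euclidDist (w l).1 (w i).1 ∧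
      Torus.euclidDist (w l).1 (w i).1 ≤ ε * (1 + 2 * L * κ) + τ / M * ‖(w i).2 - (w l).2‖} with hD
  set Ft : ℕ → Config (N + 1) (Fin 3) T3 → Fin (N + 1) → Fin (N + 1) → ℝ≥0∞ := fun M w i j =>
    ∑ l, if l ≠ i ∧ l ≠ j then (D M i l).indicator 1 w else 0 with hFt
  set F : Config (N + 1) (Fin 3) T3 → Fin (N + 1) → Fin (N + 1) → ℝ≥0∞ := fun w i _ =>
    ENNReal.ofReal (shellCount σ N L κ w i) with hF
  -- measurability
  have hEm : ∀ M i j, MeasurableSet (E M i j) := by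
    intro M i j
    set ψ : (Fin 3 → ℤ) → Config (N + 1) (Fin 3) T3 → V3 × V3 := fun k w =>
      (Torus.reprSym ((w j).1 - (w i).1) + Torus.latticeVec k, (w i).2 - (w j).2) with hψ
    have hψm : ∀ k, Measurable (ψ k) := fun k =>
      ((Torus.measurable_reprSym.comp
        ((measurable_pi_apply j).fst.sub (measurable_pi_apply i).fst)).add_const _).prodMk
        ((measurable_pi_apply i).snd.sub (measurable_pi_apply j).snd)
    have h1 : E M i j = ⋃ k, ψ k ⁻¹' {q : V3 × V3 | q.1 ∈ S M q.2} := by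
      ext w; simp only [hE, hψ, mem_setOf_eq, mem_iUnion, mem_preimage]
    rw [h1]
    exact MeasurableSet.iUnion fun k => (hSm M).preimage (hψm k)
  have hDm : ∀ M i l, MeasurableSet (D M i l) := by
    intro M i l
    have hdist : Measurable fun w : Config (N + 1) (Fin 3) T3 => Torus.euclidDist (w l).1 (w i).1 :=
      measurable_torusDist_comp (measurable_pi_apply l).fst (measurable_pi_apply i).fst
    have hrad : Measurable fun w : Config (N + 1) (Fin 3) T3 =>
        ε * (1 + 2 * L * κ) + τ / M * ‖(w i).2 - (w l).2‖ :=
      measurable_const.add (measurable_const.mul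
        ((measurable_pi_apply i).snd.sub (measurable_pi_apply l).snd).norm)
    exact (measurableSet_le measurable_const hdist).inter (measurableSet_le hdist hrad)
  have hFtm : ∀ M i j, Measurable fun w => Ft M w i j := by
    intro M i j
    simp only [hFt]
    refine Finset.measurable_sum _ fun l _ => ?_
    by_cases hl : l ≠ i ∧ l ≠ j
    · simp only [if_pos hl]; exact measurable_one.indicator (hDm M i l)
    · simp only [if_neg hl]; exact measurable_const
  -- (i) the windows cover the backward contacts
  have hEcov : ∀ (M : ℕ) (i j : Fin (N + 1)), i ≠ j →
      ∀ w ∈ hardSphereDomain (Torus.geometry (Fin 3)) (N + 1) ε, ∀ t ∈ Icc 0 (τ / M),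
      ‖(Torus.geometry (Fin 3)).sepVec ((freeFlight (Torus.geometry (Fin 3)) (-t) w i).1)
          ((freeFlight (Torus.geometry (Fin 3)) (-t) w j).1)‖ = ε → w ∈ E M i j := by
    intro M i j hij w hw t ht hc
    have hc' : ‖(Torus.geometry (Fin 3)).sepVec ((freeFlight (Torus.geometry (Fin 3)) (-t) w j).1)
        ((freeFlight (Torus.geometry (Fin 3)) (-t) w i).1)‖ = ε := by
      rw [Torus.norm_geometry_sepVec, Torus.euclidDist_comm, ← Torus.norm_geometry_sepVec, hc]
    exact exists_latticeVec_add_mem_of_contact (hScov M) hw hij.symm ht hc'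
  -- (ii) the majorant of the mark along the windows
  have hFtle : ∀ (M : ℕ) (i j : Fin (N + 1)), i ≠ j →
      ∀ w ∈ hardSphereDomain (Torus.geometry (Fin 3)) (N + 1) ε, ∀ t ∈ Icc 0 (τ / M),
      ‖(Torus.geometry (Fin 3)).sepVec ((freeFlight (Torus.geometry (Fin 3)) (-t) w i).1)
          ((freeFlight (Torus.geometry (Fin 3)) (-t) w j).1)‖ = ε →
        F (freeFlight (Torus.geometry (Fin 3)) (-t) w) i j ≤ Ft M w i j :=
    fun M i j _ w hw t ht hc => ofReal_shellCount_freeFlight_le hσ L κ hw ht hc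
  -- (iii) the window bound in Markov form
  set η₁ : ℝ := η * (N + 1 : ℝ) / ε with hη₁
  have hη₁0 : 0 < η₁ := by rw [hη₁]; positivity
  have hstat := measurePreserving_flow_localGibbsLaw_const σ a θ u N (Φ N)
  have hgen := measure_collisionSum_ge_le_liminf (Φ N) P hstat hτ F E hEm hEcov Ft hFtm hFtle
    (η := ENNReal.ofReal η₁) (ENNReal.ofReal_pos.2 hη₁0).ne' ENNReal.ofReal_ne_top
  -- (iv) the event lies in the Markov event up to the bad set
  have hsub : {z | η < ε / (N + 1 : ℝ) * threeBodyCollisionSum σ N (Φ N) τ L κ z} ⊆ (Φ N).goodᶜ ∪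
      {z | z ∈ (Φ N).good ∧ ENNReal.ofReal η₁ ≤ ∑ᶠ s ∈ collisionTimes (Torus.geometry (Fin 3)) ε
          (fun t => (Φ N).flow t z) ∩ Icc 0 τ,
        ∑ i, ∑ j, (if i ≠ j ∧ ‖(Torus.geometry (Fin 3)).sepVec ((Φ N).flow s z i).1
            ((Φ N).flow s z j).1‖ = ε then F ((Φ N).flow s z) i j else 0)} := by
    intro z hz
    by_cases hgood : z ∈ (Φ N).good
    · refine Or.inr ⟨hgood, ?_⟩
      have hγ := (Φ N).isTrajectory z hgood
      have hfin := hγ.locFinite 0 τ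
      have hfin' : (collisionTimes (Torus.geometry (Fin 3)) ε (orbit σ N (Φ N) z) ∩ Ioc 0 τ).Finite :=
        hfin.subset (inter_subset_inter_right _ Ioc_subset_Icc_self)
      have h3 : threeBodyCollisionSum σ N (Φ N) τ L κ z =
          ∑ t ∈ hfin'.toFinset, ∑ p ∈ contactPairs (Torus.geometry (Fin 3)) ε (orbit σ N (Φ N) z t),
            shellCount σ N L κ (orbit σ N (Φ N) z t) p.1 := by
        unfold threeBodyCollisionSum
        exact collisionPairSum_eq_finset_sum hfin' _
      have hK : ENNReal.ofReal (threeBodyCollisionSum σ N (Φ N) τ L κ z) ≤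
          ∑ᶠ s ∈ collisionTimes (Torus.geometry (Fin 3)) ε (fun t => (Φ N).flow t z) ∩ Icc 0 τ,
            ∑ i, ∑ j, (if i ≠ j ∧ ‖(Torus.geometry (Fin 3)).sepVec ((Φ N).flow s z i).1
                ((Φ N).flow s z j).1‖ = ε then F ((Φ N).flow s z) i j else 0) := by
        rw [finsum_mem_eq_finite_toFinset_sum _ hfin, h3,
          ENNReal.ofReal_sum_of_nonneg fun t _ =>
            Finset.sum_nonneg fun p _ => shellCount_nonneg L κ _ _]
        calc ∑ t ∈ hfin'.toFinset, ENNReal.ofReal (∑ p ∈ contactPairs (Torus.geometry (Fin 3)) ε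
                (orbit σ N (Φ N) z t), shellCount σ N L κ (orbit σ N (Φ N) z t) p.1)
            = ∑ t ∈ hfin'.toFinset, ∑ p ∈ contactPairs (Torus.geometry (Fin 3)) ε (orbit σ N (Φ N) z t),
                F (orbit σ N (Φ N) z t) p.1 p.2 :=
              Finset.sum_congr rfl fun t _ =>
                ENNReal.ofReal_sum_of_nonneg fun p _ => shellCount_nonneg L κ _ _
          _ ≤ ∑ t ∈ hfin.toFinset, ∑ p ∈ contactPairs (Torus.geometry (Fin 3)) ε (orbit σ N (Φ N) z t),
                F (orbit σ N (Φ N) z t) p.1 p.2 :=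
              Finset.sum_le_sum_of_subset (Set.Finite.toFinset_subset_toFinset.2
                (inter_subset_inter_right _ Ioc_subset_Icc_self))
          _ = _ := Finset.sum_congr rfl fun t _ =>
              sum_contactPairs_eq (hγ.mem t) (fun i j => F (orbit σ N (Φ N) z t) i j)
      have hlt : η₁ < threeBodyCollisionSum σ N (Φ N) τ L κ z := by
        have h1 : η < ε / (N + 1 : ℝ) * threeBodyCollisionSum σ N (Φ N) τ L κ z := hz
        rw [div_mul_eq_mul_div, lt_div_iff₀ (by positivity)] at h1
        rw [hη₁, div_lt_iff₀ hε]
        linarith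
      exact (ENNReal.ofReal_le_ofReal hlt.le).trans hK
    · exact Or.inl hgood
  -- (v) the mean of one window: the static three-label bound, summed over the labels
  set A : ℝ≥0∞ := ((N + 1 : ℕ) : ℝ≥0∞) ^ 3 * (ENNReal.ofReal (32 * ε ^ 2 * τ) * ENNReal.ofReal Kv *
      ENNReal.ofReal (28 * Real.pi / 3 * (2 * L * κ) * ε ^ 3)) with hA
  set B : ℝ≥0∞ := ((N + 1 : ℕ) : ℝ≥0∞) ^ 3 * (ENNReal.ofReal (32 * ε ^ 2 * τ) * ENNReal.ofReal Kv *
      ENNReal.ofReal (5 * τ)) with hB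
  have hBtop : B ≠ ∞ :=
    ENNReal.mul_ne_top (ENNReal.pow_ne_top (ENNReal.natCast_ne_top _))
      (ENNReal.mul_ne_top (ENNReal.mul_ne_top ENNReal.ofReal_ne_top ENNReal.ofReal_ne_top)
        ENNReal.ofReal_ne_top)
  have hW : ∀ M : ℕ, (M : ℝ≥0∞) * ∫⁻ w, ∑ i, ∑ j,
      (if i ≠ j then (E M i j).indicator (fun w => Ft M w i j) w else 0) ∂P ≤ A + B * (M : ℝ≥0∞)⁻¹ := by
    intro M
    rcases Nat.eq_zero_or_pos M with hM0 | hM0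
    · subst hM0
      simp only [Nat.cast_zero, zero_mul, zero_le]
    have hM' : (0 : ℝ) < M := by exact_mod_cast hM0
    have hh : 0 ≤ τ / M := by positivity
    set term : ℝ≥0∞ := ENNReal.ofReal (32 * ε ^ 2 * (τ / M)) * ENNReal.ofReal Kv *
      (ENNReal.ofReal (28 * Real.pi / 3 * (2 * L * κ) * ε ^ 3) + ENNReal.ofReal (5 * (τ / M))) with hterm
    have htriple : ∀ i j l : Fin (N + 1), i ≠ j → i ≠ l → j ≠ l → P (E M i j ∩ D M i l) ≤ term :=
      fun i j l hij hil hjl => localGibbsLaw_window_shell_le hσ hσ2 hσ8 ha hθ u (Φ N) hh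
        (by positivity) hκL
        (fun T T' hT hT' => posGibbs_tripleEvent_le hsm hij hil hjl hT hT') (hSm M) (hSvol M)
    have hpair : ∀ i j : Fin (N + 1),
        ∫⁻ w, (if i ≠ j then (E M i j).indicator (fun w => Ft M w i j) w else 0) ∂P ≤
          ∑ _l : Fin (N + 1), term := by
      intro i j
      by_cases hij : i ≠ j
      · simp only [if_pos hij]
        have hpt : ∀ w, (E M i j).indicator (fun w => Ft M w i j) w ≤
            ∑ l, (if l ≠ i ∧ l ≠ j then (E M i j ∩ D M i l).indicator 1 w else 0) := by
          intro w
          by_cases hw : w ∈ E M i j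
          · rw [indicator_of_mem hw]
            simp only [hFt]
            refine Finset.sum_le_sum fun l _ => ?_
            split_ifs
            · by_cases hwD : w ∈ D M i l
              · rw [indicator_of_mem hwD, indicator_of_mem (mem_inter hw hwD)]
              · rw [indicator_of_notMem hwD]
                exact bot_le
            · exact le_rfl
          · rw [indicator_of_notMem hw]
            exact bot_le
        have hmeas : ∀ l, Measurable fun w : Config (N + 1) (Fin 3) T3 =>
            (if l ≠ i ∧ l ≠ j then (E M i j ∩ D M i l).indicator 1 w else 0 : ℝ≥0∞) := by
          intro l
          by_cases hl : l ≠ i ∧ l ≠ j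
          · simp only [if_pos hl]; exact measurable_one.indicator ((hEm M i j).inter (hDm M i l))
          · simp only [if_neg hl]; exact measurable_const
        calc ∫⁻ w, (E M i j).indicator (fun w => Ft M w i j) w ∂P
            ≤ ∫⁻ w, ∑ l, (if l ≠ i ∧ l ≠ j then (E M i j ∩ D M i l).indicator 1 w else 0) ∂P :=
              lintegral_mono hpt
          _ = ∑ l, ∫⁻ w, (if l ≠ i ∧ l ≠ j then (E M i j ∩ D M i l).indicator 1 w else 0) ∂P :=
              lintegral_finsetSum _ fun l _ => hmeas l
          _ ≤ ∑ _l, term := by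
              refine Finset.sum_le_sum fun l _ => ?_
              by_cases hl : l ≠ i ∧ l ≠ j
              · simp only [if_pos hl]
                rw [lintegral_indicator_one ((hEm M i j).inter (hDm M i l))]
                exact htriple i j l hij hl.1.symm hl.2.symm
              · simp only [if_neg hl, lintegral_zero, zero_le]
      · simp only [if_neg hij, lintegral_zero, zero_le]
    have hmeasij : ∀ i j : Fin (N + 1), Measurable fun w : Config (N + 1) (Fin 3) T3 =>
        (if i ≠ j then (E M i j).indicator (fun w => Ft M w i j) w else 0) := by
      intro i j
      by_cases hij : i ≠ j
      · simp only [if_pos hij]; exact (hFtm M i j).indicator (hEm M i j)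
      · simp only [if_neg hij]; exact measurable_const
    have h1 : (M : ℝ≥0∞) = ENNReal.ofReal (M : ℝ) := (ENNReal.ofReal_natCast M).symm
    have h2 :
        (M : ℝ≥0∞) * ENNReal.ofReal (32 * ε ^ 2 * (τ / M)) = ENNReal.ofReal (32 * ε ^ 2 * τ) := by
      rw [h1, ← ENNReal.ofReal_mul (Nat.cast_nonneg _)]
      congr 1
      field_simp
    have h3 : ENNReal.ofReal (5 * (τ / M)) = ENNReal.ofReal (5 * τ) * (M : ℝ≥0∞)⁻¹ := by
      rw [h1, ← div_eq_mul_inv, ← ENNReal.ofReal_div_of_pos hM', mul_div_assoc]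
    calc (M : ℝ≥0∞) * ∫⁻ w, ∑ i, ∑ j,
          (if i ≠ j then (E M i j).indicator (fun w => Ft M w i j) w else 0) ∂P
        = (M : ℝ≥0∞) * ∑ i, ∑ j,
            ∫⁻ w, (if i ≠ j then (E M i j).indicator (fun w => Ft M w i j) w else 0) ∂P := by
          congr 1
          rw [lintegral_finsetSum _ fun i _ => Finset.measurable_sum _ fun j _ => hmeasij i j]
          exact Finset.sum_congr rfl fun i _ => lintegral_finsetSum _ fun j _ => hmeasij i j
      _ ≤ (M : ℝ≥0∞) * ∑ _i : Fin (N + 1), ∑ _j : Fin (N + 1), ∑ _l : Fin (N + 1), term := by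
          gcongr with i _ j _
          exact hpair i j
      _ = ((N + 1 : ℕ) : ℝ≥0∞) ^ 3 * ((M : ℝ≥0∞) * term) := by
          simp only [Finset.sum_const, Finset.card_univ, Fintype.card_fin, nsmul_eq_mul]
          ring
      _ = A + B * (M : ℝ≥0∞)⁻¹ := by
          rw [hterm, h3, hA, hB, ← h2]
          ring
  -- (vi) the `liminf` over the mesh kills the thickening error
  have hlim : liminf (fun M : ℕ => (M : ℝ≥0∞) * ∫⁻ w, ∑ i, ∑ j,
      (if i ≠ j then (E M i j).indicator (fun w => Ft M w i j) w else 0) ∂P) atTop ≤ A := by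
    have ht : Tendsto (fun M : ℕ => A + B * (M : ℝ≥0∞)⁻¹) atTop (𝓝 (A + B * 0)) :=
      tendsto_const_nhds.add
        (ENNReal.Tendsto.const_mul ENNReal.tendsto_inv_nat_nhds_zero (Or.inr hBtop))
    rw [mul_zero, add_zero] at ht
    exact (liminf_le_liminf (Eventually.of_forall hW)).trans ht.liminf_eq.le
  -- (vii) the arithmetic of the constants
  have hgood0 : P (Φ N).goodᶜ = 0 := by
    rw [hP, localGibbsLaw_eq]
    exact localGibbsMeasure_absolutelyContinuous σ _ _ _ N (Φ N) (Φ N).measure_compl_good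
  have hε3 : ((N + 1 : ℕ) : ℝ) * ε ^ 3 = σ ^ 3 := succ_mul_hsDiameter_pow_three σ N
  have hkey : (ENNReal.ofReal η₁)⁻¹ * A = ENNReal.ofReal (C * κ / η) := by
    rw [hA, ← ENNReal.ofReal_inv_of_pos hη₁0, ← ENNReal.ofReal_natCast,
      ← ENNReal.ofReal_pow (Nat.cast_nonneg _),
      ← ENNReal.ofReal_mul (by positivity), ← ENNReal.ofReal_mul (by positivity),
      ← ENNReal.ofReal_mul (by positivity), ← ENNReal.ofReal_mul (by positivity)]
    congr 1
    have hσ6 : σ ^ 6 = (((N + 1 : ℕ) : ℝ) * ε ^ 3) ^ 2 := by rw [hε3]; ring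
    rw [hη₁, hC, hσ6]
    push_cast
    field_simp
    ring
  calc P {z | η < ε / (N + 1 : ℝ) * threeBodyCollisionSum σ N (Φ N) τ L κ z}
      ≤ P ((Φ N).goodᶜ ∪ {z | z ∈ (Φ N).good ∧ ENNReal.ofReal η₁ ≤
          ∑ᶠ s ∈ collisionTimes (Torus.geometry (Fin 3)) ε (fun t => (Φ N).flow t z) ∩ Icc 0 τ,
            ∑ i, ∑ j, (if i ≠ j ∧ ‖(Torus.geometry (Fin 3)).sepVec ((Φ N).flow s z i).1
              ((Φ N).flow s z j).1‖ = ε then F ((Φ N).flow s z) i j else 0)}) := measure_mono hsub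
    _ ≤ P (Φ N).goodᶜ + P {z | z ∈ (Φ N).good ∧ ENNReal.ofReal η₁ ≤
          ∑ᶠ s ∈ collisionTimes (Torus.geometry (Fin 3)) ε (fun t => (Φ N).flow t z) ∩ Icc 0 τ,
            ∑ i, ∑ j, (if i ≠ j ∧ ‖(Torus.geometry (Fin 3)).sepVec ((Φ N).flow s z i).1
              ((Φ N).flow s z j).1‖ = ε then F ((Φ N).flow s z) i j else 0)} := measure_union_le _ _
    _ ≤ 0 + (ENNReal.ofReal η₁)⁻¹ * A := by
        rw [hgood0]
        exact add_le_add le_rfl (hgen.trans (mul_le_mul' le_rfl hlim))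
    _ = ENNReal.ofReal (C * κ / η) := by rw [zero_add, hkey]
    _ ≤ ENNReal.ofReal δ := ENNReal.ofReal_le_ofReal hκC

end Summit.AtomisticToContinuum.HydrodynamicLimit.Theorems.EvenStressEnskog

end
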